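import Literature.AlgebraicGeometry.AbelianSchemes.PolarizedAbelianSchemeWithLevelBaseChangeCancel
import Literature.AlgebraicGeometry.AbelianSchemes.AbelianSchemeOverLevelBaseChange
import Literature.AlgebraicGeometry.Motives.IntegralModelOfGlobalModel
import HarnessLib

/-!
# Base change of a pull-back relation of abelian schemes ALONG A LIFT of the base map («a twist downstairs is a twist upstairs»)

Topic `AlgebraicGeometry/AbelianSchemes`; namespaces `Literature.AlgebraicGeometry.AbelianSchemes.AbelianSchemeOver` (§1) and
`Literature.AlgebraicGeometry.Motives.IntegralModel` (§2).  THEOREMS ONLY (no def, no instance, no notation, no named fact, no `sorry`).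
Cell `hodgecm-mathlib` (D-0151), P6 «MOD programme», sub-desk P6a, GEN layer — organ «TWIST-RES» (A-p03 (g29), offer (O6) 2026-09-01):
the witness side of the (TW) `twist_spec` field of the moduli datum (design D-3 of desk F0P6a-plan (g1)): the modular twist lives on the
fine moduli scheme `𝓜ᵢ` over `B` («`u_γ^* univᵢ ≅ univᵢ ⊗ 𝔞_γ`», a pull-back relation of group schemes along `u_γ`), while the datum
reads it on the localised restricted model `𝓨 = (restrictScalarsOfIntermediate hinj 𝓜ᵢ).localise w` through `θ(γ,1) = u_γ ⊗ 𝒪_(w)`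
(★ UNIQ-θ ∕ SEMILIN).  HC_CM is proved only modulo the printed citations until rung 0 closes; nothing here is about HC.

THE MATHEMATICS ([MumfordFogartyKirwan1994] Ch. 7 §2 Def. 7.2 «`𝒜_{g,d,n}` is a contravariant functor»; [GortzWedhorn2020] Prop. 4.16,
Section (4.7)).  §1 Let `U : S₁ → S` be a morphism of schemes, `A` an abelian scheme over `S`, `A′` one over `S₁` with a pull-back relation
of group schemes `G : A′ → A` along `U` (★ `IsBaseChangeVia`), and let `π : S′ → S`, `π₁ : S₁′ → S₁`, `τ : S₁′ → S′` be a commutative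
square `τ ≫ π = π₁ ≫ U` (a LIFT of `U` to the primed bases; NOT assumed cartesian).  Then `A′ ×_{S₁} S₁′` is a pull-back of `A ×_S S′`
along `τ`, by a (unique) map `m` over the projections `m ≫ pr_A = pr_{A′} ≫ G`: both `A′ ×_{S₁} S₁′ → A` (along `π₁ ≫ U = τ ≫ π`, ★
`baseChange_isBaseChangeVia` + ★ `IsBaseChangeVia.trans`) and `A ×_S S′ → A` (along `π`) are pull-back relations to `A`, so the first
factors through the second (★ `IsBaseChangeVia.exists_comp_eq_of_comp`) and the factorisation is a pull-back relation along `τ`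
(★ `isBaseChangeVia_of_comp`, pull-back squares cancel).  §2 The INT-RES reading: for global integral models `𝒳, 𝒴` over `𝓞 F`, a model
morphism `U : 𝒳.total → 𝒴.total` and its localisation `U ⊗ 𝒪_(w) : 𝒳_(w) → 𝒴_(w)` (★ `localiseMap`), the square
`(U ⊗ 𝒪_(w)) ≫ pr_𝒴 = pr_𝒳 ≫ U` commutes (★ `baseChange_map_left_comp_fst`), so a pull-back relation `𝒜′ → 𝒜` along `U` between abelian
schemes over the global total spaces base-changes to one between `𝒜′ ×_{𝒳} 𝒳_(w)` and `𝒜 ×_{𝒴} 𝒴_(w)` along `U ⊗ 𝒪_(w)` — and along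
ANY `τ` EQUAL to `(U ⊗ 𝒪_(w))` on underlying schemes (e.g. `τ = θ(γ,1)` once ★ UNIQ-θ has identified the action with the localised
semilinear relabelling).

MAIN STATEMENTS.  §1 **`IsBaseChangeVia.exists_isBaseChangeVia_baseChange_along`**; §2 **`IsBaseChangeVia.exists_isBaseChangeVia_baseChange_localiseMap`**,
`IsBaseChangeVia.exists_isBaseChangeVia_baseChange_of_eq_localiseMap`.

## References
* [MumfordFogartyKirwan1994] D. Mumford, J. Fogarty, F. Kirwan, *Geometric Invariant Theory*, 3rd ed. (1994), Ch. 7 §2 Def. 7.2 (p. 129).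
* [GortzWedhorn2020] U. Görtz, T. Wedhorn, *Algebraic Geometry I*, 2nd ed. (2020), Prop. 4.16 (p. 101); Section (4.7) (pp. 107–108).
-/

set_option autoImplicit false

noncomputable section

universe u

open CategoryTheory CategoryTheory.Limits AlgebraicGeometry

namespace Literature.AlgebraicGeometry.AbelianSchemes

namespace AbelianSchemeOver

/-! ### §1 Pull-back relations base-change along a lift of the base map -/

variable {S S₁ S' S₁' : Scheme.{u}} {A : AbelianSchemeOver S} {A' : AbelianSchemeOver S₁}
  {U : S₁ ⟶ S} {G : A'.X.left ⟶ A.X.left}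

/-- **A pull-back relation base-changes along any lift of the base map.**  If `G : A′ → A` exhibits `A′ ∕ S₁` as the base change of
`A ∕ S` along `U : S₁ → S` (as group schemes), and `τ ≫ π = π₁ ≫ U` (`π : S′ → S`, `π₁ : S₁′ → S₁`, `τ : S₁′ → S′`), then
`A′ ×_{S₁} S₁′` is the base change of `A ×_S S′` along `τ`, by a map `m` over the projections (`m ≫ pr_A = pr_{A′} ≫ G`).
[cite: MumfordFogartyKirwan1994, Ch. 7 §2 Definition 7.2 (p. 129)] [cite: GortzWedhorn2020, Prop. 4.16 (p. 101) and Section (4.7) (pp. 107–108)] -/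
theorem IsBaseChangeVia.exists_isBaseChangeVia_baseChange_along (h : A'.IsBaseChangeVia A U G)
    (π : S' ⟶ S) (π₁ : S₁' ⟶ S₁) (τ : S₁' ⟶ S') (hτ : τ ≫ π = π₁ ≫ U) :
    ∃ m : (A'.baseChange π₁).X.left ⟶ (A.baseChange π).X.left,
      (A'.baseChange π₁).IsBaseChangeVia (A.baseChange π) τ m ∧
        m ≫ pullback.fst A.X.hom π = pullback.fst A'.X.hom π₁ ≫ G := by
  have h₁ : (A'.baseChange π₁).IsBaseChangeVia A (τ ≫ π) (pullback.fst A'.X.hom π₁ ≫ G) :=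
    hτ ▸ (A'.baseChange_isBaseChangeVia π₁).trans h
  have h₂ : (A.baseChange π).IsBaseChangeVia A π (pullback.fst A.X.hom π) := A.baseChange_isBaseChangeVia π
  obtain ⟨m, hmG, hmπ⟩ := IsBaseChangeVia.exists_comp_eq_of_comp h₁ h₂
  exact ⟨m, isBaseChangeVia_of_comp h₁ h₂ m hmG hmπ, hmG⟩

end AbelianSchemeOver

end Literature.AlgebraicGeometry.AbelianSchemes

/-! ### §2 The INT-RES reading: along the localisation of a model morphism (and along any `τ` equal to it, e.g. `θ(γ,1)` after ★ UNIQ-θ) -/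

namespace Literature.AlgebraicGeometry.Motives.IntegralModel

open Literature.AlgebraicGeometry.AbelianSchemes Literature.AlgebraicGeometry.AbelianSchemes.AbelianSchemeOver
open IsDedekindDomain
open scoped NumberField

variable {F : Type} [Field F] [NumberField F] {X Y : SchemeOver F}

/-- **A pull-back relation between abelian schemes over two global models base-changes along the LOCALISED model morphism**: for
`U : 𝒳.total → 𝒴.total` over `𝓞 F` and `G : 𝒜′ → 𝒜` a pull-back relation along `U` (`𝒜` over `𝒴.total`, `𝒜′` over `𝒳.total`), the base
changes to the localised models are related along `U ⊗ 𝒪_(w)` (★ `localiseMap`), over the projections — the square `(U ⊗ 𝒪_(w)) ≫ pr_𝒴 =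
pr_𝒳 ≫ U` is ★ `baseChange_map_left_comp_fst`. [cite: MumfordFogartyKirwan1994, Ch. 7 §2 Definition 7.2 (p. 129)]
[cite: GortzWedhorn2020, Prop. 4.16 (p. 101) and Section (4.7) (pp. 107–108)] -/
theorem IsBaseChangeVia.exists_isBaseChangeVia_baseChange_localiseMap (𝒳 : IntegralModel (𝓞 F) F X) (𝒴 : IntegralModel (𝓞 F) F Y)
    (U : 𝒳.total ⟶ 𝒴.total) (w : HeightOneSpectrum (𝓞 F)) {𝒜 : AbelianSchemeOver 𝒴.total.left} {𝒜' : AbelianSchemeOver 𝒳.total.left}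
    {G : 𝒜'.X.left ⟶ 𝒜.X.left} (h : 𝒜'.IsBaseChangeVia 𝒜 U.left G) :
    ∃ m : (𝒜'.baseChange (pullback.fst 𝒳.total.hom
              (Spec.map (CommRingCat.ofHom (algebraMap (𝓞 F) (HeightOneSpectrum.valuationSubringAtPrime F w)))))).X.left ⟶
          (𝒜.baseChange (pullback.fst 𝒴.total.hom
              (Spec.map (CommRingCat.ofHom (algebraMap (𝓞 F) (HeightOneSpectrum.valuationSubringAtPrime F w)))))).X.left,
      (𝒜'.baseChange (pullback.fst 𝒳.total.hom
          (Spec.map (CommRingCat.ofHom (algebraMap (𝓞 F) (HeightOneSpectrum.valuationSubringAtPrime F w)))))).IsBaseChangeVia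
        (𝒜.baseChange (pullback.fst 𝒴.total.hom
          (Spec.map (CommRingCat.ofHom (algebraMap (𝓞 F) (HeightOneSpectrum.valuationSubringAtPrime F w))))))
        (localiseMap 𝒳 𝒴 U w).left m ∧
      m ≫ pullback.fst 𝒜.X.hom _ = pullback.fst 𝒜'.X.hom _ ≫ G :=
  h.exists_isBaseChangeVia_baseChange_along _ _ _ (by rw [localiseMap_eq]; exact baseChange_map_left_comp_fst U)

/-- **… and along any `τ` with the same underlying morphism** (the form consumed with `τ := (θ.aut (γ,1)).hom` once ★ UNIQ-θ ∕ SEMILIN has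
identified `θ(γ,1)` with the localised semilinear relabelling: `(Over.isoMk (θ.aut (γ,1)) _).hom = localiseMap … (semilinearHomOf γ u) w`).
[cite: MumfordFogartyKirwan1994, Ch. 7 §2 Definition 7.2 (p. 129)] [cite: GortzWedhorn2020, Prop. 4.16 (p. 101) and Section (4.7) (pp. 107–108)] -/
theorem IsBaseChangeVia.exists_isBaseChangeVia_baseChange_of_eq_localiseMap (𝒳 : IntegralModel (𝓞 F) F X) (𝒴 : IntegralModel (𝓞 F) F Y)
    (U : 𝒳.total ⟶ 𝒴.total) (w : HeightOneSpectrum (𝓞 F)) {𝒜 : AbelianSchemeOver 𝒴.total.left} {𝒜' : AbelianSchemeOver 𝒳.total.left}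
    {G : 𝒜'.X.left ⟶ 𝒜.X.left} (h : 𝒜'.IsBaseChangeVia 𝒜 U.left G)
    (τ : (𝒳.localise w).total.left ⟶ (𝒴.localise w).total.left) (hτ : τ = (localiseMap 𝒳 𝒴 U w).left) :
    ∃ m : (𝒜'.baseChange (pullback.fst 𝒳.total.hom
              (Spec.map (CommRingCat.ofHom (algebraMap (𝓞 F) (HeightOneSpectrum.valuationSubringAtPrime F w)))))).X.left ⟶
          (𝒜.baseChange (pullback.fst 𝒴.total.hom
              (Spec.map (CommRingCat.ofHom (algebraMap (𝓞 F) (HeightOneSpectrum.valuationSubringAtPrime F w)))))).X.left,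
      (𝒜'.baseChange (pullback.fst 𝒳.total.hom
          (Spec.map (CommRingCat.ofHom (algebraMap (𝓞 F) (HeightOneSpectrum.valuationSubringAtPrime F w)))))).IsBaseChangeVia
        (𝒜.baseChange (pullback.fst 𝒴.total.hom
          (Spec.map (CommRingCat.ofHom (algebraMap (𝓞 F) (HeightOneSpectrum.valuationSubringAtPrime F w))))))
        τ m ∧
      m ≫ pullback.fst 𝒜.X.hom _ = pullback.fst 𝒜'.X.hom _ ≫ G := by
  subst hτ
  exact IsBaseChangeVia.exists_isBaseChangeVia_baseChange_localiseMap 𝒳 𝒴 U w h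

end Literature.AlgebraicGeometry.Motives.IntegralModel

end
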